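import Mathlib
import HarnessLib

/-!
# LINE g21-B «fibre dichotomy» (⟨stmt-QuantumFields-23125⟩) — rung R-B4a `RadialODEDichotomy` BY NAME

Crux `F4SubCurvatureDoor.RationalToGeneral` ⟨stmt-QuantumFields-23125⟩, owner file `Cruxes/RationalToGeneral/Lines/fibre_dichotomy_rungs.lean`
(ns `…FibreDichotomyRungs`).  This file restates R-B4a `RadialODEDichotomy` CHARACTER-IDENTICALLY and proves
`radialODEDichotomy_holds : RadialODEDichotomy` by an elementary Sturm-type argument (no Bessel functions).

PROOF (Sturm-type).  `W = r³ g g'` and `U = W + (L+2) r² g²` are nondecreasing (`W' = r³ g'² + (L(L+2) r + s r³) g²`,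
`U' = r (r g' + (L+2) g)² + s r³ g²`).  Boundedness on `[1, ∞)` forces `W ≤ 0` (else `g² ≥ 2 g(r₁)² log(r/r₂) → ∞`).  If `U(r₁) < 0` then
`v² = r^{2L+4} g²` (derivative `2 r^{2L+1} U`) is nonincreasing on `(0, r₁]`; if `U ≥ 0` then a zero of `g` forces `g ≡ 0`, and otherwise
`Y = ((r g' + (L+2) g)/r^L)²` is nondecreasing (`Y' = 2 s U / r^{2L+1}`) and `≤ 2(L+2)² B²/r²`, so `Y ≡ 0` and `v = r^{L+2} g` is constant.

HONEST LABEL: one rung (M) of the OPEN line g21-B; B4, B5, ⟨23125⟩, ⟨23035⟩, R2d and the Yang–Mills mass gap remain OPEN; no summit is proved by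
a line.
-/

noncomputable section

open Filter Topology Set

namespace Summit.QuantumFields.YangMills.Theorems.F4SubCurvatureDoorRadialODEDichotomyRegistered

/-- R-B4a «RADIAL ODE DICHOTOMY» (M).  [Freeden2011 Ch. 6; Widder1941; modified Bessel `K_{L+1}`] -/
def RadialODEDichotomy : Prop :=
  ∀ (L : ℕ) (s : ℝ), 1 ≤ L → 0 ≤ s → ∀ g dg ddg : ℝ → ℝ,
    (∀ r : ℝ, 0 < r → HasDerivAt g (dg r) r ∧ HasDerivAt dg (ddg r) r) →
    (∀ r : ℝ, 0 < r → ddg r + 3 / r * dg r - (((L : ℝ) * ((L : ℝ) + 2)) / r ^ 2 + s) * g r = 0) →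
    (∃ B : ℝ, ∀ r : ℝ, 1 ≤ r → |g r| ≤ B) →
    (∀ r : ℝ, 0 < r → g r = 0) ∨
    (∃ c : ℝ, 0 < c ∧ ∃ r₀ : ℝ, 0 < r₀ ∧ ∀ r : ℝ, 0 < r → r < r₀ → c ≤ r ^ (L + 2) * |g r|)

/-! ## Monotonicity from the sign of a derivative -/

/-- Nonnegative derivative on `(0, ∞)` ⇒ nondecreasing there. -/
theorem monotoneOn_Ioi_of_deriv {f f' : ℝ → ℝ} (hf : ∀ x, 0 < x → HasDerivAt f (f' x) x)
    (hf' : ∀ x, 0 < x → 0 ≤ f' x) : MonotoneOn f (Ioi 0) :=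
  monotoneOn_of_hasDerivWithinAt_nonneg (convex_Ioi 0) (fun x hx => (hf x hx).continuousAt.continuousWithinAt)
    (fun x hx => by rw [interior_Ioi] at hx ⊢; exact (hf x hx).hasDerivWithinAt)
    (fun x hx => by rw [interior_Ioi] at hx; exact hf' x hx)

/-- Nonpositive derivative on `(0, ∞)` ⇒ nonincreasing there. -/
theorem antitoneOn_Ioi_of_deriv {f f' : ℝ → ℝ} (hf : ∀ x, 0 < x → HasDerivAt f (f' x) x)
    (hf' : ∀ x, 0 < x → f' x ≤ 0) : AntitoneOn f (Ioi 0) :=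
  antitoneOn_of_hasDerivWithinAt_nonpos (convex_Ioi 0) (fun x hx => (hf x hx).continuousAt.continuousWithinAt)
    (fun x hx => by rw [interior_Ioi] at hx ⊢; exact (hf x hx).hasDerivWithinAt)
    (fun x hx => by rw [interior_Ioi] at hx; exact hf' x hx)

/-- Nonnegative derivative on `[a, ∞)` ⇒ nondecreasing there. -/
theorem monotoneOn_Ici_of_deriv {f f' : ℝ → ℝ} {a : ℝ} (hf : ∀ x, a ≤ x → HasDerivAt f (f' x) x)
    (hf' : ∀ x, a ≤ x → 0 ≤ f' x) : MonotoneOn f (Ici a) :=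
  monotoneOn_of_hasDerivWithinAt_nonneg (convex_Ici a) (fun x hx => (hf x hx).continuousAt.continuousWithinAt)
    (fun x hx => by rw [interior_Ici] at hx ⊢; exact (hf x (le_of_lt hx)).hasDerivWithinAt)
    (fun x hx => by rw [interior_Ici] at hx; exact hf' x (le_of_lt hx))

/-- Nonpositive derivative on `(0, b]` ⇒ nonincreasing there. -/
theorem antitoneOn_Ioc_of_deriv {f f' : ℝ → ℝ} {b : ℝ} (hf : ∀ x, 0 < x → HasDerivAt f (f' x) x)
    (hf' : ∀ x, 0 < x → x ≤ b → f' x ≤ 0) : AntitoneOn f (Ioc 0 b) :=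
  antitoneOn_of_hasDerivWithinAt_nonpos (convex_Ioc 0 b) (fun x hx => (hf x hx.1).continuousAt.continuousWithinAt)
    (fun x hx => by rw [interior_Ioc] at hx ⊢; exact (hf x hx.1).hasDerivWithinAt)
    (fun x hx => by rw [interior_Ioc] at hx; exact hf' x hx.1 hx.2.le)

/-! ## Derivatives of the auxiliary quantities -/

/-- `d/dx x³ = 3x²`. -/
theorem hasDerivAt_cube (r : ℝ) : HasDerivAt (fun x : ℝ => x ^ 3) (3 * r ^ 2) r := by
  simpa using hasDerivAt_pow 3 r

/-- `d/dx x² = 2x`. -/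
theorem hasDerivAt_sq (r : ℝ) : HasDerivAt (fun x : ℝ => x ^ 2) (2 * r) r := by
  simpa using hasDerivAt_pow 2 r

/-- `d/dx x^{n+1} = (n+1) xⁿ`. -/
theorem hasDerivAt_pow_succ' (n : ℕ) (r : ℝ) : HasDerivAt (fun x : ℝ => x ^ (n + 1)) (((n : ℝ) + 1) * r ^ n) r := by
  simpa using hasDerivAt_pow (n + 1) r

section ODE

variable {L : ℕ} {s : ℝ} {g dg ddg : ℝ → ℝ}

/-- The equation solved for `g''`. -/
theorem ddg_eq (hode : ∀ r : ℝ, 0 < r → ddg r + 3 / r * dg r - (((L : ℝ) * ((L : ℝ) + 2)) / r ^ 2 + s) * g r = 0)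
    {r : ℝ} (hr : 0 < r) : ddg r = -(3 / r * dg r) + (((L : ℝ) * ((L : ℝ) + 2)) / r ^ 2 + s) * g r := by
  linarith [hode r hr]

/-- `W = r³ g g'` has `W' = r³ g'² + (L(L+2) r + s r³) g²`. -/
theorem hasDerivAt_W (hg : ∀ r, 0 < r → HasDerivAt g (dg r) r) (hdg : ∀ r, 0 < r → HasDerivAt dg (ddg r) r)
    (hode : ∀ r : ℝ, 0 < r → ddg r + 3 / r * dg r - (((L : ℝ) * ((L : ℝ) + 2)) / r ^ 2 + s) * g r = 0)
    {r : ℝ} (hr : 0 < r) :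
    HasDerivAt (fun x => x ^ 3 * (g x * dg x))
      (r ^ 3 * (dg r * dg r) + (((L : ℝ) * ((L : ℝ) + 2)) * r + s * r ^ 3) * (g r * g r)) r := by
  refine ((hasDerivAt_cube r).mul ((hg r hr).mul (hdg r hr))).congr_deriv ?_
  simp only [Pi.mul_apply]
  rw [ddg_eq hode hr]
  field_simp
  ring

/-- `U = r³ g g' + (L+2) r² g²` has `U' = r (r g' + (L+2) g)² + s r³ g²`. -/
theorem hasDerivAt_U (hg : ∀ r, 0 < r → HasDerivAt g (dg r) r) (hdg : ∀ r, 0 < r → HasDerivAt dg (ddg r) r)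
    (hode : ∀ r : ℝ, 0 < r → ddg r + 3 / r * dg r - (((L : ℝ) * ((L : ℝ) + 2)) / r ^ 2 + s) * g r = 0)
    {r : ℝ} (hr : 0 < r) :
    HasDerivAt (fun x => x ^ 3 * (g x * dg x) + ((L : ℝ) + 2) * x ^ 2 * (g x * g x))
      (r * (r * dg r + ((L : ℝ) + 2) * g r) ^ 2 + s * r ^ 3 * (g r * g r)) r := by
  refine ((hasDerivAt_W hg hdg hode hr).add (((hasDerivAt_sq r).const_mul ((L : ℝ) + 2)).mul
    ((hg r hr).mul (hg r hr)))).congr_deriv ?_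
  simp only [Pi.mul_apply]
  ring

/-- `v² = r^{2L+4} g²` has derivative `2 r^{2L+1} U`. -/
theorem hasDerivAt_V (hg : ∀ r, 0 < r → HasDerivAt g (dg r) r) {r : ℝ} (hr : 0 < r) :
    HasDerivAt (fun x => x ^ (2 * L + 4) * (g x * g x))
      (2 * r ^ (2 * L + 1) * (r ^ 3 * (g r * dg r) + ((L : ℝ) + 2) * r ^ 2 * (g r * g r))) r := by
  have h := hasDerivAt_pow_succ' (2 * L + 3) r
  simp only [show 2 * L + 3 + 1 = 2 * L + 4 by ring] at h
  refine (h.mul ((hg r hr).mul (hg r hr))).congr_deriv ?_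
  simp only [Pi.mul_apply]
  push_cast
  ring

/-- `v = r^{L+2} g` has derivative `r^{L+1} (r g' + (L+2) g)`. -/
theorem hasDerivAt_v (hg : ∀ r, 0 < r → HasDerivAt g (dg r) r) {r : ℝ} (hr : 0 < r) :
    HasDerivAt (fun x => x ^ (L + 2) * g x) (r ^ (L + 1) * (r * dg r + ((L : ℝ) + 2) * g r)) r := by
  have h := hasDerivAt_pow_succ' (L + 1) r
  simp only [show L + 1 + 1 = L + 2 by ring] at h
  refine (h.mul (hg r hr)).congr_deriv ?_
  push_cast
  ring

/-- `(r g' + (L+2) g)/r^L` has derivative `s r g / r^L` (the ODE for `v = r^{L+2} g` is `(r^{-2L-1} v')' = s r^{-2L-1} v`). -/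
theorem hasDerivAt_Nq (hL : 1 ≤ L) (hg : ∀ r, 0 < r → HasDerivAt g (dg r) r)
    (hdg : ∀ r, 0 < r → HasDerivAt dg (ddg r) r)
    (hode : ∀ r : ℝ, 0 < r → ddg r + 3 / r * dg r - (((L : ℝ) * ((L : ℝ) + 2)) / r ^ 2 + s) * g r = 0)
    {r : ℝ} (hr : 0 < r) :
    HasDerivAt (fun x => (x * dg x + ((L : ℝ) + 2) * g x) / x ^ L) (s * r * g r / r ^ L) r := by
  have hN : HasDerivAt (fun x => x * dg x + ((L : ℝ) + 2) * g x) (1 * dg r + r * ddg r + ((L : ℝ) + 2) * dg r) r :=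
    ((hasDerivAt_id' r).mul (hdg r hr)).add ((hg r hr).const_mul _)
  have hD : HasDerivAt (fun x : ℝ => x ^ L) ((L : ℝ) * r ^ (L - 1)) r := hasDerivAt_pow L r
  have hrL : r ^ L ≠ 0 := pow_ne_zero _ hr.ne'
  refine (hN.div hD hrL).congr_deriv ?_
  have hpL : r ^ L = r * r ^ (L - 1) := by rw [← pow_succ', Nat.sub_add_cancel hL]
  have hq : r ^ (L - 1) ≠ 0 := pow_ne_zero _ hr.ne'
  rw [ddg_eq hode hr, hpL]
  field_simp
  ring

/-- STEP 1: boundedness on `[1, ∞)` forces `W = r³ g g' ≤ 0` on `(0, ∞)`. -/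
theorem W_nonpos (hL : 1 ≤ L) (hs : 0 ≤ s) (hg : ∀ r, 0 < r → HasDerivAt g (dg r) r)
    (hdg : ∀ r, 0 < r → HasDerivAt dg (ddg r) r)
    (hode : ∀ r : ℝ, 0 < r → ddg r + 3 / r * dg r - (((L : ℝ) * ((L : ℝ) + 2)) / r ^ 2 + s) * g r = 0)
    {B : ℝ} (hB : ∀ r : ℝ, 1 ≤ r → |g r| ≤ B) {r₁ : ℝ} (hr₁ : 0 < r₁) : r₁ ^ 3 * (g r₁ * dg r₁) ≤ 0 := by
  rcases le_or_gt (r₁ ^ 3 * (g r₁ * dg r₁)) 0 with h | hw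
  · exact h
  exfalso
  have hL3 : (3 : ℝ) ≤ (L : ℝ) * ((L : ℝ) + 2) := by
    have : (1 : ℝ) ≤ L := by exact_mod_cast hL
    nlinarith
  obtain ⟨w, hwdef⟩ : ∃ w, w = r₁ ^ 3 * (g r₁ * dg r₁) := ⟨_, rfl⟩
  obtain ⟨g₁, hg₁def⟩ : ∃ g₁, g₁ = g r₁ * g r₁ := ⟨_, rfl⟩
  rw [← hwdef] at hw
  have hg₁ : 0 < g₁ := by
    rw [hg₁def]
    rcases (mul_self_nonneg (g r₁)).lt_or_eq with h | h
    · exact h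
    exfalso
    have h0 : g r₁ = 0 := mul_self_eq_zero.1 h.symm
    rw [hwdef, h0, zero_mul, mul_zero] at hw
    exact lt_irrefl _ hw
  -- `W` is nondecreasing on `(0, ∞)`
  have hWmono : MonotoneOn (fun x => x ^ 3 * (g x * dg x)) (Ioi 0) :=
    monotoneOn_Ioi_of_deriv (fun r hr => hasDerivAt_W hg hdg hode hr) fun r hr =>
      add_nonneg (mul_nonneg (pow_pos hr 3).le (mul_self_nonneg _)) (mul_nonneg (by positivity) (mul_self_nonneg _))
  have hWge : ∀ r, r₁ ≤ r → w ≤ r ^ 3 * (g r * dg r) := fun r hr => by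
    rw [hwdef]; exact hWmono (mem_Ioi.2 hr₁) (mem_Ioi.2 (lt_of_lt_of_le hr₁ hr)) hr
  -- `g²` is nondecreasing on `[r₁, ∞)`
  have hsqmono : MonotoneOn (fun x => g x * g x) (Ici r₁) :=
    monotoneOn_Ici_of_deriv (fun r hr => (hg r (lt_of_lt_of_le hr₁ hr)).mul (hg r (lt_of_lt_of_le hr₁ hr)))
      fun r hr => by
        have hr0 : 0 < r := lt_of_lt_of_le hr₁ hr
        have h1 := hWge r hr
        have h2 : 0 ≤ g r * dg r := le_of_not_gt fun h => by nlinarith [pow_pos hr0 3]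
        linarith
  have hsq_ge : ∀ r, r₁ ≤ r → g₁ ≤ g r * g r := fun r hr => by
    rw [hg₁def]; exact hsqmono (mem_Ici.2 le_rfl) (mem_Ici.2 hr) hr
  -- `Φ₁ = W − (3/2) g₁ r²` is nondecreasing on `[r₁, ∞)`
  have hΦ₁ : MonotoneOn (fun x => x ^ 3 * (g x * dg x) - 3 / 2 * g₁ * x ^ 2) (Ici r₁) :=
    monotoneOn_Ici_of_deriv
      (fun r hr => (hasDerivAt_W hg hdg hode (lt_of_lt_of_le hr₁ hr)).sub ((hasDerivAt_sq r).const_mul (3 / 2 * g₁)))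
      fun r hr => by
        have hr0 : 0 < r := lt_of_lt_of_le hr₁ hr
        have h1 := hsq_ge r hr
        have h2 : 0 ≤ r * (g r * g r) := mul_nonneg hr0.le (mul_self_nonneg _)
        have h3 : r * g₁ ≤ r * (g r * g r) := mul_le_mul_of_nonneg_left h1 hr0.le
        nlinarith [mul_nonneg (pow_pos hr0 3).le (mul_self_nonneg (dg r)),
          mul_nonneg (mul_nonneg hs (pow_pos hr0 3).le) (mul_self_nonneg (g r)), mul_nonneg (sub_nonneg.2 hL3) h2]
  have hW2 : ∀ r, r₁ ≤ r → w + 3 / 2 * g₁ * (r ^ 2 - r₁ ^ 2) ≤ r ^ 3 * (g r * dg r) := fun r hr => by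
    have := hΦ₁ (mem_Ici.2 le_rfl) (mem_Ici.2 hr) hr
    simp only at this
    rw [hwdef]
    linarith
  -- on `[r₂, ∞)`, `r₂ = max (2 r₁) 1`: `W ≥ g₁ r²`
  obtain ⟨r₂, hr₂def⟩ : ∃ r₂, r₂ = max (2 * r₁) 1 := ⟨_, rfl⟩
  have hr₂1 : 1 ≤ r₂ := hr₂def ▸ le_max_right _ _
  have hr₂r : 2 * r₁ ≤ r₂ := hr₂def ▸ le_max_left _ _
  have hr₂0 : 0 < r₂ := by linarith
  have hW3 : ∀ r, r₂ ≤ r → g₁ * r ^ 2 ≤ r ^ 3 * (g r * dg r) := fun r hr => by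
    have h := hW2 r (by linarith)
    have h4 : 0 ≤ (r - 2 * r₁) * (r + 2 * r₁) := mul_nonneg (by linarith) (by linarith)
    nlinarith [mul_nonneg hg₁.le h4]
  -- `Φ₂ = g² − 2 g₁ log r` is nondecreasing on `[r₂, ∞)`
  have hΦ₂ : MonotoneOn (fun x => g x * g x - 2 * g₁ * Real.log x) (Ici r₂) :=
    monotoneOn_Ici_of_deriv
      (fun r hr => ((hg r (by linarith)).mul (hg r (by linarith))).sub
        ((Real.hasDerivAt_log (by linarith : r ≠ 0)).const_mul (2 * g₁)))
      fun r hr => by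
        have hr0 : 0 < r := by linarith
        have h := hW3 r hr
        have h' : g₁ * r⁻¹ ≤ g r * dg r := by
          rw [← div_eq_mul_inv, div_le_iff₀ hr0]
          exact le_of_not_gt fun h5 => by nlinarith [pow_pos hr0 2]
        linarith
  have hsq2 : ∀ r, r₂ ≤ r → 2 * g₁ * (Real.log r - Real.log r₂) ≤ g r * g r := fun r hr => by
    have := hΦ₂ (mem_Ici.2 le_rfl) (mem_Ici.2 hr) hr
    simp only at this
    linarith [mul_self_nonneg (g r₂)]
  -- evaluate at `R = r₂ exp((B² + 1)/(2 g₁))`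
  obtain ⟨E, hEdef⟩ : ∃ E : ℝ, E = (B ^ 2 + 1) / (2 * g₁) := ⟨_, rfl⟩
  have hE0 : 0 ≤ E := by rw [hEdef]; positivity
  obtain ⟨R, hRdef⟩ : ∃ R : ℝ, R = r₂ * Real.exp E := ⟨_, rfl⟩
  have hRr₂ : r₂ ≤ R := by
    rw [hRdef]
    have := Real.add_one_le_exp E
    nlinarith
  have hlog : Real.log R - Real.log r₂ = E := by
    rw [hRdef, Real.log_mul hr₂0.ne' (Real.exp_pos E).ne', Real.log_exp]
    ring
  have h1 := hsq2 R hRr₂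
  have h2 : 2 * g₁ * E = B ^ 2 + 1 := by
    rw [hEdef]
    field_simp
  have h3 : g R * g R ≤ B ^ 2 := by
    have hb := hB R (le_trans hr₂1 hRr₂)
    have h4 : |g R| * |g R| ≤ B * B := mul_self_le_mul_self (abs_nonneg _) hb
    rw [abs_mul_abs_self] at h4
    nlinarith
  rw [hlog] at h1
  linarith

end ODE

/-! ## The rung -/

/-- **RUNG R-B4a (by name): `RadialODEDichotomy`.** -/
theorem radialODEDichotomy_holds : RadialODEDichotomy := by
  intro L s hL hs g dg ddg hder hode hbdd
  have hg : ∀ r, 0 < r → HasDerivAt g (dg r) r := fun r hr => (hder r hr).1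
  have hdg : ∀ r, 0 < r → HasDerivAt dg (ddg r) r := fun r hr => (hder r hr).2
  obtain ⟨B, hB⟩ := hbdd
  have hL2 : (0 : ℝ) < (L : ℝ) + 2 := by positivity
  have hWle : ∀ r, 0 < r → r ^ 3 * (g r * dg r) ≤ 0 := fun r hr => W_nonpos hL hs hg hdg hode hB hr
  -- `U` nondecreasing, `g²` nonincreasing on `(0, ∞)`
  have hUmono : MonotoneOn (fun x => x ^ 3 * (g x * dg x) + ((L : ℝ) + 2) * x ^ 2 * (g x * g x)) (Ioi 0) :=
    monotoneOn_Ioi_of_deriv (fun r hr => hasDerivAt_U hg hdg hode hr) fun r hr =>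
      add_nonneg (mul_nonneg hr.le (sq_nonneg _)) (mul_nonneg (mul_nonneg hs (pow_pos hr 3).le) (mul_self_nonneg _))
  have hsq_anti : AntitoneOn (fun x => g x * g x) (Ioi 0) :=
    antitoneOn_Ioi_of_deriv (fun r hr => (hg r hr).mul (hg r hr)) fun r hr => by
      have h1 := hWle r hr
      have h2 : g r * dg r ≤ 0 := le_of_not_gt fun h => by nlinarith [pow_pos hr 3]
      linarith
  by_cases hA : ∃ r₁, 0 < r₁ ∧ r₁ ^ 3 * (g r₁ * dg r₁) + ((L : ℝ) + 2) * r₁ ^ 2 * (g r₁ * g r₁) < 0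
  · -- CASE A: `U(r₁) < 0` — `v²` is nonincreasing on `(0, r₁]`
    obtain ⟨r₁, hr₁, hU₁⟩ := hA
    right
    have hVanti : AntitoneOn (fun x => x ^ (2 * L + 4) * (g x * g x)) (Ioc 0 r₁) :=
      antitoneOn_Ioc_of_deriv (fun r hr => hasDerivAt_V hg hr) fun r hr hrle => by
        have hU : r ^ 3 * (g r * dg r) + ((L : ℝ) + 2) * r ^ 2 * (g r * g r)
            ≤ r₁ ^ 3 * (g r₁ * dg r₁) + ((L : ℝ) + 2) * r₁ ^ 2 * (g r₁ * g r₁) :=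
          hUmono (mem_Ioi.2 hr) (mem_Ioi.2 hr₁) hrle
        nlinarith [pow_pos hr (2 * L + 1)]
    have hg₁ : g r₁ ≠ 0 := by
      intro h0
      rw [h0, zero_mul, mul_zero, mul_zero, mul_zero, add_zero] at hU₁
      exact lt_irrefl _ hU₁
    have hVsq : ∀ x : ℝ, x ^ (2 * L + 4) * (g x * g x) = (x ^ (L + 2) * |g x|) ^ 2 := fun x => by
      rw [mul_pow, ← pow_mul, show (L + 2) * 2 = 2 * L + 4 by ring, sq_abs, pow_two]
    refine ⟨r₁ ^ (L + 2) * |g r₁|, mul_pos (pow_pos hr₁ _) (abs_pos.2 hg₁), r₁, hr₁, fun r hr hrr => ?_⟩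
    have hV := hVanti ⟨hr, hrr.le⟩ ⟨hr₁, le_rfl⟩ hrr.le
    simp only [hVsq] at hV
    exact (pow_le_pow_iff_left₀ (by positivity) (by positivity) two_ne_zero).1 hV
  · -- CASE B: `U ≥ 0` everywhere — `v²` is nondecreasing on `(0, ∞)`
    have hU0 : ∀ r, 0 < r → 0 ≤ r ^ 3 * (g r * dg r) + ((L : ℝ) + 2) * r ^ 2 * (g r * g r) := by
      intro r hr
      rcases le_or_gt 0 (r ^ 3 * (g r * dg r) + ((L : ℝ) + 2) * r ^ 2 * (g r * g r)) with h | h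
      · exact h
      exact absurd ⟨r, hr, h⟩ hA
    have hVmono : MonotoneOn (fun x => x ^ (2 * L + 4) * (g x * g x)) (Ioi 0) :=
      monotoneOn_Ioi_of_deriv (fun r hr => hasDerivAt_V hg hr) fun r hr => mul_nonneg (by positivity) (hU0 r hr)
    by_cases hz : ∃ r, 0 < r ∧ g r = 0
    · -- a zero of `g` forces `g ≡ 0`
      obtain ⟨r₃, hr₃, hg₃⟩ := hz
      left
      intro r hr
      rcases le_total r₃ r with h | h
      · have h1 := hsq_anti (mem_Ioi.2 hr₃) (mem_Ioi.2 hr) h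
        simp only [hg₃, mul_zero] at h1
        exact mul_self_eq_zero.1 (le_antisymm h1 (mul_self_nonneg _))
      · have h1 := hVmono (mem_Ioi.2 hr) (mem_Ioi.2 hr₃) h
        simp only [hg₃, mul_zero] at h1
        have hp : 0 < r ^ (2 * L + 4) := pow_pos hr _
        have h2 : g r * g r ≤ 0 := le_of_not_gt fun h5 => by nlinarith
        exact mul_self_eq_zero.1 (le_antisymm h2 (mul_self_nonneg _))
    · -- `g` has no zero: `Y = ((r g' + (L+2) g)/r^L)²` is nondecreasing and tends to `0`, hence vanishes
      have hnz : ∀ r, 0 < r → g r ≠ 0 := fun r hr h0 => hz ⟨r, hr, h0⟩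
      right
      obtain ⟨Nq, hNqdef⟩ : ∃ Nq : ℝ → ℝ, Nq = fun x => (x * dg x + ((L : ℝ) + 2) * g x) / x ^ L := ⟨_, rfl⟩
      have hYmono : MonotoneOn (fun x => Nq x * Nq x) (Ioi 0) := by
        refine monotoneOn_Ioi_of_deriv (f' := fun r => s * r * g r / r ^ L * Nq r + Nq r * (s * r * g r / r ^ L))
          (fun r hr => ?_) fun r hr => ?_
        · rw [hNqdef]
          exact (hasDerivAt_Nq hL hg hdg hode hr).mul (hasDerivAt_Nq hL hg hdg hode hr)
        · have hgN : 0 ≤ g r * (r * dg r + ((L : ℝ) + 2) * g r) := by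
            have := hU0 r hr
            exact le_of_not_gt fun h5 => by nlinarith [pow_pos hr 2]
          have hrL : r ^ L ≠ 0 := pow_ne_zero _ hr.ne'
          have e : s * r * g r / r ^ L * Nq r + Nq r * (s * r * g r / r ^ L)
              = 2 * s * r / (r ^ L) ^ 2 * (g r * (r * dg r + ((L : ℝ) + 2) * g r)) := by
            rw [hNqdef]
            field_simp
            ring
          rw [e]
          exact mul_nonneg (by positivity) hgN
      -- upper bound on `[1, ∞)`
      have hYle : ∀ r, 1 ≤ r → Nq r * Nq r ≤ 2 * ((L : ℝ) + 2) ^ 2 * B ^ 2 / r ^ 2 := by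
        intro r hr1
        have hr : 0 < r := by linarith
        have hW := hWle r hr
        have hU := hU0 r hr
        have hgg : 0 < g r * g r := mul_self_pos.2 (hnz r hr)
        have hb : g r * g r ≤ B ^ 2 := by
          have h4 : |g r| * |g r| ≤ B * B := mul_self_le_mul_self (abs_nonneg _) (hB r hr1)
          rw [abs_mul_abs_self] at h4
          nlinarith
        have h1 : r * (g r * dg r) ≤ 0 := le_of_not_gt fun h5 => by nlinarith [pow_pos hr 2]
        have h2 : -(((L : ℝ) + 2) * (g r * g r)) ≤ r * (g r * dg r) := le_of_not_gt fun h5 => by nlinarith [pow_pos hr 2]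
        have h3 : (r * dg r) ^ 2 ≤ ((L : ℝ) + 2) ^ 2 * (g r * g r) := by
          have h4 : (r * (g r * dg r)) ^ 2 ≤ (((L : ℝ) + 2) * (g r * g r)) ^ 2 := by
            have h6 : 0 ≤ ((L : ℝ) + 2) * (g r * g r) := mul_nonneg hL2.le hgg.le
            nlinarith
          exact le_of_not_gt fun h5 => by nlinarith
        have hN : (r * dg r + ((L : ℝ) + 2) * g r) ^ 2 ≤ 2 * ((L : ℝ) + 2) ^ 2 * (g r * g r) := by
          nlinarith [mul_nonpos_iff.2 (Or.inl ⟨hL2.le, h1⟩)]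
        have hrL : r ^ 2 ≤ (r ^ L) ^ 2 := by
          rw [← pow_mul]
          exact pow_le_pow_right₀ hr1 (by omega)
        calc Nq r * Nq r = (r * dg r + ((L : ℝ) + 2) * g r) ^ 2 / (r ^ L) ^ 2 := by
              rw [hNqdef]
              simp only
              rw [div_mul_div_comm, ← pow_two, ← pow_two]
          _ ≤ 2 * ((L : ℝ) + 2) ^ 2 * (g r * g r) / (r ^ L) ^ 2 := div_le_div_of_nonneg_right hN (by positivity)
          _ ≤ 2 * ((L : ℝ) + 2) ^ 2 * B ^ 2 / (r ^ L) ^ 2 := by gcongr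
          _ ≤ 2 * ((L : ℝ) + 2) ^ 2 * B ^ 2 / r ^ 2 := div_le_div_of_nonneg_left (by positivity) (by positivity) hrL
      -- `Y ≡ 0`
      have hY0 : ∀ r, 0 < r → Nq r * Nq r = 0 := by
        intro r hr
        have hle : ∀ R, max r 1 ≤ R → Nq r * Nq r ≤ 2 * ((L : ℝ) + 2) ^ 2 * B ^ 2 / R ^ 2 := fun R hR =>
          (hYmono (mem_Ioi.2 hr) (mem_Ioi.2 (by linarith [le_max_right r 1]))
            (le_trans (le_max_left _ _) hR)).trans (hYle R (le_trans (le_max_right _ _) hR))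
        have ht : Tendsto (fun R : ℝ => 2 * ((L : ℝ) + 2) ^ 2 * B ^ 2 / R ^ 2) atTop (𝓝 0) :=
          tendsto_const_nhds.div_atTop (tendsto_pow_atTop two_ne_zero)
        have h := ge_of_tendsto ht (eventually_atTop.2 ⟨max r 1, hle⟩)
        exact le_antisymm h (mul_self_nonneg _)
      have hN0 : ∀ r, 0 < r → r * dg r + ((L : ℝ) + 2) * g r = 0 := by
        intro r hr
        have h := mul_self_eq_zero.1 (hY0 r hr)
        rw [hNqdef] at h
        simp only at h
        rcases div_eq_zero_iff.1 h with h5 | h5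
        · exact h5
        · exact absurd h5 (pow_ne_zero _ hr.ne')
      -- `v = r^{L+2} g` is constant on `(0, ∞)`
      have hvconst : ∀ r, 0 < r → r ^ (L + 2) * g r = g 1 := by
        intro r hr
        have key := Convex.norm_image_sub_le_of_norm_hasDerivWithin_le
          (f := fun x => x ^ (L + 2) * g x) (f' := fun x => x ^ (L + 1) * (x * dg x + ((L : ℝ) + 2) * g x))
          (s := Ioi (0 : ℝ)) (C := 0) (fun x hx => (hasDerivAt_v hg hx).hasDerivWithinAt)
          (fun x hx => by simp only [hN0 x hx, mul_zero, norm_zero, le_refl]) (convex_Ioi 0)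
          (mem_Ioi.2 one_pos) (mem_Ioi.2 hr)
        rw [zero_mul, norm_le_zero_iff, sub_eq_zero] at key
        rw [key, one_pow, one_mul]
      refine ⟨|g 1|, abs_pos.2 (hnz 1 one_pos), 1, one_pos, fun r hr _ => ?_⟩
      rw [← hvconst r hr, abs_mul, abs_of_pos (pow_pos hr _)]

end Summit.QuantumFields.YangMills.Theorems.F4SubCurvatureDoorRadialODEDichotomyRegistered

end
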